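import Summits.MatrixMultiplication.MatrixMultiplication.Theorems.SoloInformedTwistedMatchingsEffective
import Summits.MatrixMultiplication.MatrixMultiplication.Theorems.SoloInformedTranslationSchemes
import HarnessLib

/-!
# Effective Theorem B″ for `𝔽_p^k`-hosts: realizations and translation schemes

Solo-informed seat (MatrixMultiplication), gen 101; sharpest-statement §2y(7)(B)/(8), effective form.
With `θ_p(u) = u^{-(p-1)/3} Σ_{j<p} u^j` (`0 < u ≤ 1`; `inf_u θ_p(u) = p^{1-δ′_p}`, the Ellenberg–Gijswijt
constant: `1.88988` for `p = 2`, `2.7551` for `p = 3`):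
`realization_effective_card_ge_behrend` — if `α, β, γ : [3N]² → S`, `S` abelian of exponent `p`,
`|S| = p^k`, realize `⟨3N,3N,3N⟩` for the twisted triangle predicate of ANY finite family of
automorphism pairs (Cohn–Umans Def. 12 form), then `N² e^{-4√(log N)} ≤ 3 θ_p(u)^k`;
`translationScheme_effective_card_ge_behrend` — the same for a realization in the translation scheme
`𝒮(S, M₀)`, `M₀ ≤ Aut S` arbitrary, with CU13 Def. 11 triangles. E.g. `p = 2`: a translation scheme over
`𝔽_2^k` realizing `⟨n,n,n⟩` (`n = 3N`) has `2^k ≥ (n² e^{-4√log n}/27)^{1/0.9183}`, i.e.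
`|S| ≥ n^{2.178 - o(1)}`, whence rank·`|M₀| ≥ n^{2.178-o(1)}` and Conj. 21 needs `|M₀| ≥ n^{0.178-o(1)}`.
References: CohnUmans2013 (arXiv:1207.6528) Def. 11/12, §5; EllenbergGijswijt2017; BCCGNSU17
(arXiv:1605.06702) Thm 4.14; Behrend (1946).
-/

noncomputable section

open scoped BigOperators
open Finset

namespace Summit.MatrixMultiplication.MatrixMultiplication.Theorems.TwistedSliceRank

section EffectiveHeadline

/-- **Effective B″, realization form.** `S` abelian of exponent `p`, `|S| = p^k`; a Cohn–Umans
Def. 12 realization of `⟨3N,3N,3N⟩` by the twisted triangle predicate of finitely many automorphism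
pairs forces `N² e^{-4√(log N)} ≤ 3 θ_p(u)^k` for every `0 < u ≤ 1`. [this work] -/
theorem realization_effective_card_ge_behrend (p : ℕ) [Fact p.Prime] (S : Type) [CommGroup S]
    [Fintype S] [DecidableEq S] (hexpS : ∀ g : S, g ^ p = 1) (k : ℕ)
    (hSk : Fintype.card S = p ^ k) (σ : Type) [Fintype σ] (φ ψ : σ → S ≃* S) (N : ℕ)
    (α β γ : Fin (3 * N) × Fin (3 * N) → S)
    (hreal : ∀ x y z : Fin (3 * N) × Fin (3 * N),
      (∃ s : σ, α x * φ s (β y) * ψ s (γ z) = 1) ↔ (y.1 = x.2 ∧ z = (y.2, x.1)))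
    (u : ℝ) (hu0 : 0 < u) (hu1 : u ≤ 1) :
    ((N : ℝ) ^ 2 * Real.exp (-4 * Real.sqrt (Real.log N))) ≤
      3 * (u ^ (-(((p - 1 : ℕ) : ℝ) / 3)) * ∑ j : Fin p, u ^ ((j : ℕ) : ℝ)) ^ k := by
  obtain ⟨t, htN, htcard, ht⟩ := rothNumberNat_spec N
  obtain ⟨a, b, c, -, hind⟩ := threeAPFree_inducedMatching ht htN
  -- the induced matching is a twisted matching
  have hmatch : ∀ i j l : ↥t × Fin N,
      (∃ s : σ, α (a i, b i) * φ s (β (b j, c j)) * ψ s (γ (c l, a l)) = 1) ↔ (i = j ∧ j = l) := by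
    intro i j l
    rw [hreal (a i, b i) (b j, c j) (c l, a l)]
    constructor
    · rintro ⟨h1, h2⟩
      simp only [Prod.mk.injEq] at h2
      exact hind i j l h1 h2.1 h2.2
    · rintro ⟨rfl, rfl⟩
      exact ⟨rfl, rfl⟩
  have h := twistedMatching_card_le_effective p S hexpS k hSk σ φ ψ (↥t × Fin N)
    (fun i => α (a i, b i)) (fun j => β (b j, c j)) (fun l => γ (c l, a l)) hmatch u hu0 hu1
  have hcard : Fintype.card (↥t × Fin N) = rothNumberNat N * N := by
    rw [Fintype.card_prod, Fintype.card_coe, htcard, Fintype.card_fin]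
  rw [hcard] at h
  push_cast at h
  have hB : (N : ℝ) * Real.exp (-4 * Real.sqrt (Real.log N)) ≤ rothNumberNat N :=
    Behrend.roth_lower_bound
  have hN : (0 : ℝ) ≤ N := Nat.cast_nonneg N
  calc (N : ℝ) ^ 2 * Real.exp (-4 * Real.sqrt (Real.log N))
      = ((N : ℝ) * Real.exp (-4 * Real.sqrt (Real.log N))) * N := by ring
    _ ≤ (rothNumberNat N : ℝ) * N := mul_le_mul_of_nonneg_right hB hN
    _ ≤ _ := h

/-- **Effective B″, translation-scheme form (CU13 Def. 11/12).** `S` abelian of exponent `p`,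
`|S| = p^k`, `M₀ ≤ Aut S` arbitrary, `c` an orbit labelling; a realization of `⟨3N,3N,3N⟩` in
`𝒮(S, M₀)` forces `N² e^{-4√(log N)} ≤ 3 θ_p(u)^k` for every `0 < u ≤ 1`. [this work] -/
theorem translationScheme_effective_card_ge_behrend (p : ℕ) [Fact p.Prime] (S : Type)
    [CommGroup S] [Fintype S] [DecidableEq S] (hexpS : ∀ g : S, g ^ p = 1) (k : ℕ)
    (hSk : Fintype.card S = p ^ k) (M₀ : Subgroup (MulAut S)) (C : Type) (c : S → C)
    (hc : ∀ g h : S, c g = c h ↔ ∃ φ : M₀, (φ : MulAut S) g = h) (N : ℕ)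
    (A B Γ : Fin (3 * N) × Fin (3 * N) → C)
    (hreal : ∀ x y z : Fin (3 * N) × Fin (3 * N),
      (∃ g h l : S, c g = A x ∧ c h = B y ∧ c l = Γ z ∧ g * h * l = 1) ↔
        (y.1 = x.2 ∧ z = (y.2, x.1)))
    (u : ℝ) (hu0 : 0 < u) (hu1 : u ≤ 1) :
    ((N : ℝ) ^ 2 * Real.exp (-4 * Real.sqrt (Real.log N))) ≤
      3 * (u ^ (-(((p - 1 : ℕ) : ℝ) / 3)) * ∑ j : Fin p, u ^ ((j : ℕ) : ℝ)) ^ k := by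
  rcases Nat.eq_zero_or_pos N with hN | hN
  · subst hN
    simp only [Nat.cast_zero, ne_eq, OfNat.ofNat_ne_zero, not_false_eq_true, zero_pow, zero_mul]
    positivity
  haveI : Finite (MulAut S) :=
    Finite.of_injective (fun e : MulAut S => (e : S → S)) DFunLike.coe_injective
  haveI : Fintype (↥M₀ × ↥M₀) := Fintype.ofFinite _
  have w : Fin (3 * N) := ⟨0, by omega⟩
  have hA : ∀ x, ∃ g : S, c g = A x := fun x => by
    obtain ⟨g, h, l, hg, -, -, -⟩ := (hreal x (x.2, w) (w, x.1)).2 ⟨rfl, rfl⟩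
    exact ⟨g, hg⟩
  have hB : ∀ y, ∃ g : S, c g = B y := fun y => by
    obtain ⟨g, h, l, -, hh, -, -⟩ := (hreal (w, y.1) y (y.2, w)).2 ⟨rfl, rfl⟩
    exact ⟨h, hh⟩
  have hΓ : ∀ z, ∃ g : S, c g = Γ z := fun z => by
    obtain ⟨g, h, l, -, -, hl, -⟩ := (hreal (z.2, w) (w, z.1) z).2 ⟨rfl, Prod.ext rfl rfl⟩
    exact ⟨l, hl⟩
  choose α hα using hA
  choose β hβ using hB
  choose γ hγ using hΓ
  refine realization_effective_card_ge_behrend p S hexpS k hSk (↥M₀ × ↥M₀)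
    (fun s => (s.1 : MulAut S)) (fun s => (s.2 : MulAut S)) N α β γ (fun x y z => ?_) u hu0 hu1
  rw [← hreal x y z]
  exact (triangle_iff_twisted M₀ c hc (hα x) (hβ y) (hγ z)).symm

end EffectiveHeadline

end Summit.MatrixMultiplication.MatrixMultiplication.Theorems.TwistedSliceRank
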